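import Mathlib

/-!
# Route BarrierLever — item `PartitionMinorsHitByVP` (19717): the COLUMN COUNT of a one-piece exact-support design
Helper file (`--supports stmt-ValiantsHypothesis-19717`; cell valiant-natproofs, 𝒟-side door (c), line `hidden_states`, uniform-menu
lane; prover seat val-np-p3 gen 12). Definition-free; closes NO item. For a one-piece design with exact ranges the columns are in
bijection with the live patterns `g`, `g f ∈ {none} ∪ S 0 f`: **`card_columns_eq_prod`**: `n = ∏_f (|S 0 f| + 1)`. This is the size
bookkeeping every shallow case of `Stmt.pieceKill` (memo val-np-p3 g12 §2(g)) starts from: with live slots `f₁, f₂` of sizes `s₁, s₂`,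
`n = (s₁+1)(s₂+1)·Q` with `Q = ∏_{f ≠ f₁,f₂}(|S 0 f|+1) ≥ 1` (`card_columns_two_slots`). Nothing on crux 14610 or VP ≠ VNP.
-/

set_option linter.dupNamespace false

namespace Summit.ValiantsHypothesis.ValiantsHypothesis.Theorems.BarrierLever.SimplexJoin

open Finset Matrix

/-- **Column count.** A one-piece exact-support design with `n` columns has `n = ∏_f (|S 0 f| + 1)`. -/
theorem card_columns_eq_prod {D N n : ℕ} (S : Fin 1 → Fin D → Finset (Fin N))
    (e : Fin n → Fin 1 × (Fin D → Option (Fin N))) (he : Function.Injective e)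
    (hlive : ∀ c : Fin 1 × (Fin D → Option (Fin N)),
      c ∈ Set.range e ↔ ∀ (f : Fin D) (j : Fin N), c.2 f = some j → j ∈ S c.1 f) :
    n = ∏ f : Fin D, ((S 0 f).card + 1) := by
  classical
  -- the live patterns
  set P : Finset (Fin D → Option (Fin N)) := Fintype.piFinset fun f => Finset.insertNone (S 0 f) with hP
  have hcardP : P.card = ∏ f : Fin D, ((S 0 f).card + 1) := by
    rw [hP, Fintype.card_piFinset]
    exact Finset.prod_congr rfl fun f _ => Finset.card_insertNone _
  -- `k ↦ (e k).2` is a bijection from `Fin n` onto `P`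
  have hmem : ∀ k, (e k).2 ∈ P := by
    intro k
    rw [hP, Fintype.mem_piFinset]
    intro f
    rw [Finset.mem_insertNone]
    intro j hj
    have := ((hlive (e k)).mp ⟨k, rfl⟩) f j hj
    rwa [show (e k).1 = 0 from Subsingleton.elim _ _] at this
  have hinj : Function.Injective fun k => (e k).2 := by
    intro k k' hkk'
    exact he (Prod.ext (Subsingleton.elim _ _) hkk')
  have hsurj : ∀ g ∈ P, ∃ k, (e k).2 = g := by
    intro g hg
    have : ((0 : Fin 1), g) ∈ Set.range e := by
      rw [hlive]
      intro f j hj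
      rw [hP, Fintype.mem_piFinset] at hg
      exact Finset.mem_insertNone.mp (hg f) j (Option.mem_def.mpr hj)
    obtain ⟨k, hk⟩ := this
    exact ⟨k, by rw [hk]⟩
  have himage : (Finset.univ : Finset (Fin n)).image (fun k => (e k).2) = P := by
    ext g
    simp only [Finset.mem_image, Finset.mem_univ, true_and]
    exact ⟨fun ⟨k, hk⟩ => hk ▸ hmem k, fun hg => hsurj g hg⟩
  rw [← hcardP, ← himage, Finset.card_image_of_injective _ hinj, Finset.card_univ, Fintype.card_fin]

/-- **Two-slot form.** With distinct slots `f₁, f₂`: `n = (|S 0 f₁| + 1)·(|S 0 f₂| + 1)·Q` where `Q ≥ 1` is the product over the other slots. -/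
theorem card_columns_two_slots {D N n : ℕ} (S : Fin 1 → Fin D → Finset (Fin N))
    (e : Fin n → Fin 1 × (Fin D → Option (Fin N))) (he : Function.Injective e)
    (hlive : ∀ c : Fin 1 × (Fin D → Option (Fin N)),
      c ∈ Set.range e ↔ ∀ (f : Fin D) (j : Fin N), c.2 f = some j → j ∈ S c.1 f)
    (f₁ f₂ : Fin D) (hf : f₁ ≠ f₂) :
    n = ((S 0 f₁).card + 1) * ((S 0 f₂).card + 1) *
      ∏ f ∈ (Finset.univ.erase f₁).erase f₂, ((S 0 f).card + 1) ∧
    1 ≤ ∏ f ∈ (Finset.univ.erase f₁).erase f₂, ((S 0 f).card + 1) := by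
  classical
  refine ⟨?_, Finset.prod_pos fun f _ => Nat.succ_pos _⟩
  rw [card_columns_eq_prod S e he hlive, ← Finset.mul_prod_erase _ _ (Finset.mem_univ f₁),
    ← Finset.mul_prod_erase _ _ (Finset.mem_erase.mpr ⟨hf.symm, Finset.mem_univ f₂⟩), mul_assoc]

end Summit.ValiantsHypothesis.ValiantsHypothesis.Theorems.BarrierLever.SimplexJoin
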